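import Summits.RiemannHypothesis.RiemannHypothesis.Theorems.Splittings.RobinFiniteHeightLaw
import Summits.RiemannHypothesis.RiemannHypothesis.Theorems.Splittings.RobinFiniteE1cUpperNicolas
import HarnessLib


/-!
# RobinFiniteLowHeightInputs — gen 11 low-height CA law, part 1/4 (A): generic-height inputs

Cell rh-split, seat rh-split-robin-finite g11 (card `cards/SPLIT-robin-finite.md` §18).  Gen 9's height law
(`RobinFiniteHeightLaw`) is stated for verification heights `T ≥ H_PT = 3 000 175 332 800`; parts 1–4 type the SAME law
`RH(T) ∧ {Büthe 2016 Thm 2, Büthe 2018 Thm 2, BKLNW 2021} ⟹ Robin at every CA number with primes ≤ X(T)` at EVERY `T ≥ 10⁵`.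
This part: the `θ`-window at height `T` reaching `B` as soon as `4.92·√(B/log B) ≤ T` (kernel table `ThetaSmallRange` on
`[599, 8886113]`, Büthe 2016 above), the budget ⟹ Büthe-range lemma (the tail price `tailH(T) ≤ log T/(πT)` for
`T ≥ 10⁵` is the tree's `RobinFiniteE1c.tailPrice_le_log_div`, imported),
and the pointwise lower bound `−log f(P) ≤ Eb(0.0463 + (1 + 2/log P)·tailH·√P)(P)` (`RobinFiniteTailFree`).  0 `def`.

HONEST LABEL: SPLITTING SEARCH over kernel-typed RH-EQUIVALENCES; a splitting A ∧ B ⟹ RH is CONDITIONAL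
bookkeeping unless A and B are both proved; nothing here bears on the truth of RH.
-/

set_option linter.dupNamespace false

noncomputable section

open Real Filter Finset
open scoped Chebyshev

namespace Summit.RiemannHypothesis.RiemannHypothesis.Theorems.Splittings.RobinFiniteC1

open Literature.NumberTheory.LFunctions Literature.NumberTheory.DiophantineGeometry
open RobinAnalyticSharp RobinAnalyticSharp.Cells
open Summit.RiemannHypothesis.RiemannHypothesis.Theorems.Splittings.RobinFiniteE3

section LowHeight

/-! ### A · generic-height inputs: the `θ`-window, the tail price, Büthe's range -/

/-- **The `θ`-window at ANY verification height `T > 0`**: `|θ y − y| ≤ √y log² y/(8π)` on `[599, B]` as soon as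
`4.92·√(B/log B) ≤ T` — the kernel table `ThetaSmallRange.abs_theta_sub_le_smallRange` on `[599, 8886113]` (unconditional)
and Büthe 2016 Thm 2 with RH verified to `T` above (`buthe_range_mono`). -/
theorem thetaWindow_low (h16 : Buthe2016_thm2) {T B : ℝ} (hT : 0 < T)
    (hRH : RiemannHypothesisUpTo T) (hB : 4.92 * Real.sqrt (B / Real.log B) ≤ T) :
    ∀ y : ℝ, 599 ≤ y → y ≤ B → |θ y - y| ≤ √y * Real.log y ^ 2 / (8 * π) := by
  intro y hy hyB
  by_cases hs : y ≤ 8886113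
  · exact abs_theta_sub_le_smallRange hy hs
  · rw [not_le] at hs
    have hey : Real.exp 1 ≤ y := le_trans (le_trans Real.exp_one_lt_d9.le (by norm_num)) hs.le
    have h1 := (h16 T hT hRH y (buthe_range_mono hey hyB hB)).2.1 (by linarith)
    calc |θ y - y| ≤ Real.sqrt y / (8 * π) * Real.log y ^ 2 := h1
      _ = _ := by ring

/-- `log(T/2π) ≥ 1` for `T ≥ 20` (`2πe ≤ 17.08`). -/
theorem one_le_log_div_two_pi {T : ℝ} (hT : 20 ≤ T) : 1 ≤ Real.log (T / (2 * π)) := by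
  have hπu := Real.pi_lt_d6
  have hT0 : 0 < T := by linarith
  rw [Real.le_log_iff_exp_le (div_pos hT0 (by positivity)), le_div_iff₀ (by positivity)]
  have he := Real.exp_one_lt_d9
  have h1 : Real.exp 1 * (2 * π) ≤ 2.7182818286 * 6.283186 :=
    mul_le_mul he.le (by linarith) (by positivity) (by norm_num)
  linarith

/-- `tailH(T) ≥ 2/(πT)` for `T ≥ 20`, hence a budget `tailH(T)·u ≤ 1/2` (`u ≥ 0`) forces `u ≤ πT/4`. -/
theorem le_of_tail_budget {T u : ℝ} (hT : 20 ≤ T) (hu : 0 ≤ u)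
    (h : ((Real.log (T / (2 * π)) + 1) / (π * T) + (184 + 30 * Real.log T) / T ^ 2) * u ≤ 1 / 2) :
    u ≤ π * T / 4 := by
  have hT0 : 0 < T := by linarith
  have hπT : 0 < π * T := mul_pos Real.pi_pos hT0
  have hlog := one_le_log_div_two_pi hT
  have hlogT : 0 ≤ Real.log T := Real.log_nonneg (by linarith)
  have htail : 2 / (π * T) ≤ (Real.log (T / (2 * π)) + 1) / (π * T) + (184 + 30 * Real.log T) / T ^ 2 := by
    have h1 : 2 / (π * T) ≤ (Real.log (T / (2 * π)) + 1) / (π * T) :=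
      div_le_div_of_nonneg_right (by linarith) hπT.le
    have h2 : 0 ≤ (184 + 30 * Real.log T) / T ^ 2 := div_nonneg (by linarith) (sq_nonneg T)
    linarith
  have h2 : 2 / (π * T) * u ≤ 1 / 2 := le_trans (mul_le_mul_of_nonneg_right htail hu) h
  rw [div_mul_eq_mul_div, div_le_iff₀ hπT] at h2
  linarith

/-- **Büthe's range condition from the size of the window**: `4¹¹ ≤ X`, `√X ≤ πT/4` give `4.92·√(X/log X) ≤ T`
(`X ≤ π²T²/16 ≤ 0.617·T²`, `log X ≥ 15.249`, `0.617/15.249 ≤ 1/24.2064`). -/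
theorem buthe_range_low {T X : ℝ} (hT : 0 < T) (hX : (4 : ℝ) ^ 11 ≤ X) (h : √X ≤ π * T / 4) :
    4.92 * Real.sqrt (X / Real.log X) ≤ T := by
  have hπu := Real.pi_lt_d6
  have hX0 : 0 < X := lt_of_lt_of_le (by norm_num) hX
  have hsX : 0 ≤ √X := Real.sqrt_nonneg X
  have hXT : X ≤ 0.617 * T ^ 2 := by
    have h1 : √X * √X ≤ (π * T / 4) * (π * T / 4) := mul_le_mul h h hsX (by positivity)
    rw [Real.mul_self_sqrt hX0.le] at h1
    nlinarith [mul_pos hT hT, mul_nonneg (sub_nonneg.2 hπu.le) Real.pi_pos.le]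
  have hlogX : (15.249 : ℝ) ≤ Real.log X := by
    obtain ⟨-, hL, -⟩ := range_facts (k := 11) (by norm_num)
    have hL' : (15.249 : ℝ) ≤ ((L1 11 : ℚ) : ℝ) := by simp only [L1, l2]; push_cast; norm_num
    exact hL'.trans (hL.trans (Real.log_le_log (by norm_num) hX))
  have hq : X / Real.log X ≤ (T / 4.92) ^ 2 := by
    have e : (T / 4.92) ^ 2 = T ^ 2 / 24.2064 := by ring
    rw [e, div_le_div_iff₀ (by linarith) (by norm_num)]
    nlinarith [mul_nonneg (sq_nonneg T) (sub_nonneg.2 hlogX)]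
  calc 4.92 * Real.sqrt (X / Real.log X) ≤ 4.92 * Real.sqrt ((T / 4.92) ^ 2) :=
        mul_le_mul_of_nonneg_left (Real.sqrt_le_sqrt hq) (by norm_num)
    _ = T := by rw [Real.sqrt_sq (by positivity)]; ring

/-- **The pointwise lower bound at height `T`** (`partialNicolasBetween1_tailFree` with the one-point window `X₀ = X₁ = P`):
RH to height `T ≥ 7`, the `θ`-window on `[599, B]`, `599 ≤ P ≤ B` give
`−log f(P) ≤ Eb(0.0463 + (1 + 2/log P)·tailH(T)·√P)(P)`. -/
theorem negLog_le_Eb_point (hB : Buthe2018_thm2_theta) (hK : BroadbentEtAl2021_theta_rel_1e19)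
    {T B P : ℝ} (hT : 7 ≤ T) (hRH : RiemannHypothesisUpTo T)
    (hW : ∀ y : ℝ, 599 ≤ y → y ≤ B → |θ y - y| ≤ √y * Real.log y ^ 2 / (8 * π))
    (hP : 599 ≤ P) (hPB : P ≤ B) :
    -Real.log (nicolasF P) ≤ RobinAnalyticSharp.nicolasERH P +
        (0.0463 + (1 + 2 / Real.log P) *
          (((Real.log (T / (2 * π)) + 1) / (π * T) + (184 + 30 * Real.log T) / T ^ 2) * √P) - nicolasBeta) *
          (1 / (√P * Real.log P) + 1 / (√P * Real.log P ^ 2) + 4 / (√P * Real.log P ^ 3)) :=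
  partialNicolasBetween1_tailFree hB hK (X₀ := P) (X₁ := P) hT (by linarith) hPB hRH hW P hP le_rfl le_rfl

end LowHeight

end Summit.RiemannHypothesis.RiemannHypothesis.Theorems.Splittings.RobinFiniteC1

end
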